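import Literature.NumberTheory.LFunctions.MertensFirstChainCheck
import HarnessLib

/-!
# Rosser–Schoenfeld's (3.22) on `[319, 442439]` by kernel computation: certified run, chunk 1 of 2

Topic: `Literature/NumberTheory/LFunctions`. Pure proof file (a kernel computation; nothing is
asserted, no definition). Part of the discharge programme of
`Literature.NumberTheory.LFunctions.RosserSchoenfeld1962_eq_3_22` (Rosser–Schoenfeld 1962, Thm. 6
(3.22)). `run1` evaluates `MertensFirstChain.runDM 20000` — at most `20000` steps of the Mertens chain
of `MertensFirstChainCheck.lean` along the prime table `ChainTable.table`, each certifying the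
primality of the next entry, extending the enclosure of `log p` and the majorants of
`∑_{q ≤ p} (log q)/q`, `∑_{q ≤ p} (log q)/(q(q−1))`, and performing the comparison behind (3.22) at the
new prime — on the initial state `MertensFirstChain.initM` (the prime `2`) and records the resulting
state (the prime `224743`, entry `20000` of `table.tail`). The meaning of these states is supplied by
`MertensFirstChain.runDM_sound` (`MertensFirstChainSound.lean`); the two chunks are assembled in
`MertensFirstSmallRange.lean`. The expected state was obtained by evaluating the same function.
`decide +kernel`, standard axioms only (about half a minute of kernel time; `maxHeartbeats 0` lifts
the deterministic time-out for this one declaration).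

## References

* J. B. Rosser, L. Schoenfeld, Illinois J. Math. 6 (1962), 64–94, Thm. 6 (3.22) and p. 87.
  [RosserSchoenfeld1962]
-/

namespace Literature.NumberTheory.LFunctions.MertensFirstChainRun

open MertensFirstChain

set_option maxHeartbeats 0 in
/-- **Chunk 1 of the certified Mertens run** (steps `0` to `20000`, primes `2` to `224743`).
[cite: RosserSchoenfeld1962, Thm. 6 (3.22)] -/
theorem run1 :
    runDM 20000 initM =
    some ⟨224743, 14897245679027811038026167, 14897245679028286644533155,
        13289279305559807331808632, 913176825354206810855071⟩ := by
  decide +kernel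

end Literature.NumberTheory.LFunctions.MertensFirstChainRun
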